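import Mathlib
import Summits.ValiantsHypothesis.ValiantsHypothesis.Theorems.MonotoneRestorationOrbitRestorationQPLevelAction
import Summits.ValiantsHypothesis.ValiantsHypothesis.Theorems.MonotoneRestorationMixingScaleDefs
import HarnessLib

/-!
# M4a of the line `mixing-scale`: THE ESSENTIAL SPACE OF EVEN-INVARIANT CLASS SUMS IS STABLE AND SMALL (ORBIT currency)

Route MonotoneRestoration, crux `OrbitRestorationQP` (stmt-ValiantsHypothesis-18293), line `mixing-scale` (val-idea-12, skeleton
`Cruxes/OrbitRestorationQP/Lines/mixing_scale.lean`), statement **M4a** `EssStableAlt` (Theorems-side vocabulary `…MixingScaleDefs.lean`;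
the critic's PB1 split of Theorem S′), a hypothesis of the registered stub M4c `stub_polyScaleStructure`.  Landed here BY NAME as
`essStableAlt : EssStableAlt` in namespace `Summit.ValiantsHypothesis.ValiantsHypothesis.Theorems.OrbitRestorationQPMixingScale`.

THE ARGUMENT (Theorems-side port of the PROVED section `M4a` of the skeleton, rev 6, authored by val-idea-12): the port of
`LevelStructure.Setting.{Λ, finrank_Λ_le, nlPart_mem_adjoin_Λ, admissible_Λ, E_stable, finrank_E_le}` (`…LevelStructureA.lean`) for an
ARBITRARY labelling `cl` of the terms of a clean representation with plain rank-diameter `Θ`, with the matching `perm_clusterSum` (the only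
consumer of separation `Setting.hsep`) replaced by the hypothesis that the class sums are FIXED (`a' = a`).  For each label `a` the space
`Λ_a = span(1, gcd-free factors of the class)` has `dim ≤ 1 + m²Θ` (diameter only) and `nlPart F_a ∈ ℂ[Λ_a]`, so the essential space
`ess (nlPart F_a)` has dimension `≤ 1 + m²Θ`; `E := ⨆_{F_a ≠ 0} ess (nlPart F_a)` is INTRINSIC to the polynomials `F_a` (the gauge freedom
inside a class never enters), hence is mapped into itself by every `(σ, τ)` fixing the class sums (`ess_map`, `nlPart_map`, `ess_C_mul`), and
`dim E ≤ m(1 + m²Θ)`.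

* `ofibre`, `oΛ`, `olabs`, `oE` — the fibre, the space `Λ_a`, the labels with nonzero class sum, the essential space;
* `finrank_oΛ_le`, `nlPart_mem_adjoin_oΛ`, `admissible_oΛ`, `oE_stable`, `finrank_oE_le`;
* `essStableAlt` — **M4a**.

Everything is proved (no named fact is used).  Honest framing: M4a is one S-sized input of the line; M4c/M5 and the rung
`ProductDepthRestorationQP (fun _ => 1)` stay OPEN; nothing here bears on VP ≠ VNP. [cite: KarninShpilka2009, §3]
-/

noncomputable section

open MvPolynomial Equiv Literature.Computability.AlgebraicComplexity

-- `Summit.ValiantsHypothesis.ValiantsHypothesis.…` is the tree's single-conjunct layout (Sub = Summit).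
set_option linter.dupNamespace false

namespace Summit.ValiantsHypothesis.ValiantsHypothesis.Theorems.OrbitRestorationQPMixingScale

open RankDistance LevelRep LevelStructure LinNL LinearSubalgebra

section M4a

variable {n D : ℕ} {f : MvPolynomial (Fin n × Fin n) ℂ} (R : CleanRep f D) (cl : Fin R.m → Fin R.m) (Θ : ℕ)

/-- The fibre of a label. [folklore] -/
def ofibre (a : Fin R.m) : Finset (Fin R.m) := Finset.univ.filter fun i => cl i = a

open Classical in
/-- The space `Λ_a`: the span of `1` and the gcd-free factors of the class of `a`. [folklore] -/
def oΛ (a : Fin R.m) : Submodule ℂ (MvPolynomial (Fin n × Fin n) ℂ) :=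
  if h : (ofibre R cl a).Nonempty then Submodule.span ℂ (insert (C 1) (simplePart R.L (ofibre R cl a) h))
  else Submodule.span ℂ {C 1}

/-- `Λ_a` of a nonempty fibre. [folklore] -/
theorem oΛ_eq {a : Fin R.m} (h : (ofibre R cl a).Nonempty) :
    oΛ R cl a = Submodule.span ℂ (insert (C 1) (simplePart R.L (ofibre R cl a) h)) := by
  rw [oΛ, dif_pos h]

/-- `1 ∈ Λ_a`. [folklore] -/
theorem one_mem_oΛ (a : Fin R.m) : C 1 ∈ oΛ R cl a := by
  by_cases h : (ofibre R cl a).Nonempty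
  · rw [oΛ_eq R cl h]; exact Submodule.subset_span (Set.mem_insert _ _)
  · rw [oΛ, dif_neg h]; exact Submodule.subset_span rfl

/-- `Λ_a` consists of affine forms. [folklore] -/
theorem oΛ_le_deg1 (a : Fin R.m) : oΛ R cl a ≤ deg1 ℂ (Fin n × Fin n) := by
  have h1 : (C 1 : MvPolynomial (Fin n × Fin n) ℂ) ∈ deg1 ℂ (Fin n × Fin n) :=
    mem_deg1.2 (by rw [totalDegree_C]; exact Nat.zero_le _)
  by_cases h : (ofibre R cl a).Nonempty
  · rw [oΛ_eq R cl h, Submodule.span_le]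
    rintro q (rfl | ⟨i, hi, hq⟩)
    · exact h1
    · exact mem_deg1.2 (R.hdeg i q (Multiset.mem_of_le (Multiset.sub_le_self _ _) hq)).le
  · rw [oΛ, dif_neg h, Submodule.span_le]
    rintro q rfl; exact h1

/-- `Λ_a` is finite-dimensional of dimension `≤ 1 + m²Θ` (uses the DIAMETER only). [folklore] -/
theorem finrank_oΛ_le (hdiam : ∀ i j, cl i = cl j → rdist (R.L i) (R.L j) ≤ Θ) (a : Fin R.m) :
    FiniteDimensional ℂ (oΛ R cl a) ∧ Module.finrank ℂ (oΛ R cl a) ≤ 1 + R.m ^ 2 * Θ := by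
  have h1fin : FiniteDimensional ℂ (Submodule.span ℂ {(C 1 : MvPolynomial (Fin n × Fin n) ℂ)}) :=
    FiniteDimensional.span_of_finite ℂ (Set.finite_singleton _)
  have h1 : Module.finrank ℂ (Submodule.span ℂ {(C 1 : MvPolynomial (Fin n × Fin n) ℂ)}) ≤ 1 := by
    have := finrank_span_le_card (R := ℂ) ({(C 1 : MvPolynomial (Fin n × Fin n) ℂ)} : Set (MvPolynomial (Fin n × Fin n) ℂ))
    simpa using this
  by_cases h : (ofibre R cl a).Nonempty
  · haveI := simplePart_span_finite R.L (ofibre R cl a) h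
    rw [oΛ_eq R cl h, Set.insert_eq, Submodule.span_union]
    refine ⟨inferInstance, (Submodule.finrank_add_le_finrank_add_finrank _ _).trans (Nat.add_le_add h1 ?_)⟩
    refine (finrank_simplePart_le R.L (ofibre R cl a) h).trans ?_
    calc ∑ i ∈ ofibre R cl a, ∑ j ∈ ofibre R cl a, rdist (R.L i) (R.L j)
        ≤ ∑ i ∈ ofibre R cl a, ∑ j ∈ ofibre R cl a, Θ := Finset.sum_le_sum fun i hi => Finset.sum_le_sum fun j hj =>
          hdiam i j (by rw [(Finset.mem_filter.1 hi).2, (Finset.mem_filter.1 hj).2])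
      _ = (ofibre R cl a).card * ((ofibre R cl a).card * Θ) := by
          rw [Finset.sum_const, Finset.sum_const, smul_eq_mul, smul_eq_mul]
      _ ≤ R.m * (R.m * Θ) := Nat.mul_le_mul (by simpa using Finset.card_le_univ (ofibre R cl a))
          (Nat.mul_le_mul_right _ (by simpa using Finset.card_le_univ (ofibre R cl a)))
      _ = R.m ^ 2 * Θ := by ring
  · rw [oΛ, dif_neg h]
    exact ⟨h1fin, h1.trans (by omega)⟩

/-- A label with nonzero class sum has nonempty fibre. [folklore] -/
theorem ofibre_nonempty {a : Fin R.m} (ha : R.clusterSum cl a ≠ 0) : (ofibre R cl a).Nonempty := by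
  by_contra h
  refine ha (R.clusterSum_eq_zero cl fun ⟨i, hi⟩ => h ⟨i, ?_⟩)
  simp [ofibre, hi]

/-- **The non-linear part of a nonzero class sum lies in `ℂ[Λ_a]`.** [cite: KarninShpilka2009, §3] -/
theorem nlPart_mem_adjoin_oΛ {a : Fin R.m} (ha : R.clusterSum cl a ≠ 0) :
    nlPart (R.clusterSum cl a) ∈ Algebra.adjoin ℂ (oΛ R cl a : Set (MvPolynomial (Fin n × Fin n) ℂ)) := by
  have hne := ofibre_nonempty R cl ha
  set G := (ofibre R cl a).inf' hne R.L with hG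
  set P : MvPolynomial (Fin n × Fin n) ℂ := ∑ i ∈ ofibre R cl a, C (R.a i) * (R.L i - G).prod with hP
  have hGle : ∀ i ∈ ofibre R cl a, G ≤ R.L i := fun i hi => Finset.inf'_le _ hi
  have hFa : R.clusterSum cl a = G.prod * P := by
    rw [CleanRep.clusterSum, hP, Finset.mul_sum]
    have : (Finset.univ.filter fun i => cl i = a) = ofibre R cl a := rfl
    rw [this]
    refine Finset.sum_congr rfl fun i hi => ?_
    rw [CleanRep.T]
    conv_lhs => rw [← add_tsub_cancel_of_le (hGle i hi), Multiset.prod_add]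
    ring
  have hGdeg : ∀ q ∈ G, q.totalDegree = 1 := fun q hq => by
    obtain ⟨i, hi⟩ := hne
    exact R.hdeg i q (Multiset.mem_of_le (hGle i hi) hq)
  have hP0 : P ≠ 0 := by rintro hP0; rw [hFa, hP0, mul_zero] at ha; exact ha rfl
  have hPmem : P ∈ Algebra.adjoin ℂ (oΛ R cl a : Set (MvPolynomial (Fin n × Fin n) ℂ)) := by
    rw [hP]
    refine Subalgebra.sum_mem _ fun i hi => Subalgebra.mul_mem _ (Subalgebra.algebraMap_mem _ _)
      (Subalgebra.multiset_prod_mem _ fun q hq => Algebra.subset_adjoin ?_)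
    rw [oΛ_eq R cl hne]
    exact Submodule.subset_span (Set.mem_insert_of_mem _ ⟨i, hi, hq⟩)
  have h1 : Associated (nlPart (R.clusterSum cl a)) (nlPart P) := by rw [hFa]; exact nlPart_affine_mul hGdeg hP0
  have h2 : nlPart P ∈ Algebra.adjoin ℂ (oΛ R cl a : Set (MvPolynomial (Fin n × Fin n) ℂ)) :=
    nlPart_mem_adjoin (oΛ_le_deg1 R cl a) (one_mem_oΛ R cl a) hPmem hP0
  obtain ⟨w, hw⟩ := h1.symm
  obtain ⟨u, -, hwu⟩ := MvPolynomial.isUnit_iff_eq_C_of_isReduced.1 w.isUnit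
  rw [← hw, hwu]
  exact Subalgebra.mul_mem _ h2 (Subalgebra.algebraMap_mem _ u)

/-- `Λ_a` is admissible for the non-linear part of a nonzero class sum. [folklore] -/
theorem admissible_oΛ {a : Fin R.m} (ha : R.clusterSum cl a ≠ 0) : Admissible (nlPart (R.clusterSum cl a)) (oΛ R cl a) :=
  ⟨oΛ_le_deg1 R cl a, one_mem_oΛ R cl a, nlPart_mem_adjoin_oΛ R cl ha⟩

open Classical in
/-- The labels with nonzero class sum. [folklore] -/
def olabs : Finset (Fin R.m) := Finset.univ.filter fun a => R.clusterSum cl a ≠ 0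

/-- The essential space `E := ⨆_{F_a ≠ 0} ess (nlPart F_a)`. [folklore] -/
def oE : Submodule ℂ (MvPolynomial (Fin n × Fin n) ℂ) := (olabs R cl).sup fun a => ess (nlPart (R.clusterSum cl a))

/-- **`E` is stable under every `(σ, τ)` fixing the class sums** — `E_stable` with `a' = a`. [folklore] -/
theorem oE_stable (σ τ : Perm (Fin n)) (hfix : ∀ a, mact σ τ (R.clusterSum cl a) = R.clusterSum cl a) :
    (oE R cl).map (mact σ τ).toLinearEquiv.toLinearMap ≤ oE R cl := by
  unfold oE
  rw [Submodule.map_le_iff_le_comap, Finset.sup_le_iff]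
  intro a ha
  rw [← Submodule.map_le_iff_le_comap]
  have hFa0 : R.clusterSum cl a ≠ 0 := (Finset.mem_filter.1 ha).2
  have h1 : ess (mact σ τ (nlPart (R.clusterSum cl a))) =
      (ess (nlPart (R.clusterSum cl a))).map (mact σ τ).toLinearEquiv.toLinearMap :=
    ess_map (mact σ τ) (fun q hq => by rw [totalDegree_mact]; exact hq)
      (fun q hq => by
        have := totalDegree_mact σ τ ((mact σ τ).symm q)
        rw [AlgEquiv.apply_symm_apply] at this
        rw [← this]; exact hq) _
  have h2 : Associated (nlPart (R.clusterSum cl a)) (mact σ τ (nlPart (R.clusterSum cl a))) := by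
    have h := nlPart_map (mact σ τ) (totalDegree_mact σ τ) hFa0
    rw [hfix a] at h
    exact h
  obtain ⟨w, hw⟩ := h2
  obtain ⟨u, hu, hwu⟩ := MvPolynomial.isUnit_iff_eq_C_of_isReduced.1 w.isUnit
  have h3 : ess (mact σ τ (nlPart (R.clusterSum cl a))) = ess (nlPart (R.clusterSum cl a)) := by
    rw [← hw, hwu, mul_comm, ess_C_mul hu.ne_zero]
  rw [← h1, h3]
  exact Finset.le_sup (f := fun a => ess (nlPart (R.clusterSum cl a))) ha

/-- `E` is finite-dimensional of dimension `≤ m(1 + m²Θ)`. [folklore] -/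
theorem finrank_oE_le (hdiam : ∀ i j, cl i = cl j → rdist (R.L i) (R.L j) ≤ Θ) :
    FiniteDimensional ℂ (oE R cl) ∧ Module.finrank ℂ (oE R cl) ≤ R.m * (1 + R.m ^ 2 * Θ) := by
  haveI hfin : ∀ a, FiniteDimensional ℂ (ess (nlPart (R.clusterSum cl a))) := fun a =>
    Submodule.finiteDimensional_of_le (admissible_ess _).1
  refine ⟨by unfold oE; infer_instance, ?_⟩
  unfold oE
  refine (finrank_finset_sup_le (olabs R cl) _).trans ?_
  calc ∑ a ∈ olabs R cl, Module.finrank ℂ (ess (nlPart (R.clusterSum cl a)))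
      ≤ ∑ a ∈ olabs R cl, (1 + R.m ^ 2 * Θ) := Finset.sum_le_sum fun a ha => by
        haveI := (finrank_oΛ_le R cl Θ hdiam a).1
        exact (finrank_ess_le (admissible_oΛ R cl (Finset.mem_filter.1 ha).2)).trans (finrank_oΛ_le R cl Θ hdiam a).2
    _ = (olabs R cl).card * (1 + R.m ^ 2 * Θ) := by rw [Finset.sum_const, smul_eq_mul]
    _ ≤ R.m * (1 + R.m ^ 2 * Θ) := Nat.mul_le_mul_right _ (by simpa using Finset.card_le_univ (olabs R cl))

end M4a

/-- **M4a — `EssStableAlt`** (statement of the line, Theorems-side vocabulary; port of the skeleton's PROVED `essStableAlt`, rev 6,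
val-idea-12): for any labelling with plain rank-diameter `Θ` whose class sums are fixed by the even row/column renamings, the essential
space `⨆_{F_a ≠ 0} ess (nlPart F_a)` is mapped into itself by every even `(σ, τ)`, is finite-dimensional, and has `finrank ≤ m(1 + m²Θ)`.
[cite: KarninShpilka2009, §3] -/
theorem essStableAlt : EssStableAlt := by
  classical
  intro n D f R cl Θ hdiam hfix
  have hE : ((Finset.univ.filter fun a => R.clusterSum cl a ≠ 0).sup fun a => ess (nlPart (R.clusterSum cl a))) = oE R cl := by
    unfold oE olabs; congr 1
  rw [hE]
  refine ⟨fun σ τ hσ hτ => ?_, (finrank_oE_le R cl Θ hdiam).1, (finrank_oE_le R cl Θ hdiam).2⟩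
  exact oE_stable R cl σ τ fun a => hfix a σ τ hσ hτ

end Summit.ValiantsHypothesis.ValiantsHypothesis.Theorems.OrbitRestorationQPMixingScale

end
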